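import Literature.Algebra.EuclideanLattices.KhotReduction
import Literature.Computability.Complexity.CodeFPLists
import Literature.Computability.Complexity.CodeFPBudgets
import HarnessLib

/-!
# Khot 2005, §7.3 (machine level): the INPUT side of the explicit map on codes — fields, sets, guard, coin blocks

Topic `Algebra/EuclideanLattices`, namespace `Literature.Algebra.EuclideanLattices.Khot`. Support file for
the machine hypothesis of `gapSVP_const_isNPHardRandomized_of_prop6_of_FP_explicit` /
`Khot2005_SAT_randReducible_gapSVP_of_prop6_of_FP_explicit` (some `F ∈ FP` computes
`⟨code I, c⟩ ↦ code (khotOutputExplicit k I c)`; `KhotExplicitReduction.lean`, `KhotSVPHardnessProofs.lean`).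
The input of that `F` is FIXED by the statement: the code `SetCoverInstance.encoding.encode I` of
`GapSetCover.lean` (`⟨bin u, ⟨listBool (listBool bin) [S_j]_j, bin K⟩⟩`) paired with the coin string
`c`. This file reads it in the typed polynomial-time algebra `CodeFP` (`CodeFP.lean`):

* `scE` (the instance code) IS the `CodeFP` product code `tupE` of the tuple `(u, [S_j]_j, K)`
  (`scE_eq_tupE`), whence the fields on codes: `univSizeFP`, `kFP`, `setsRawFP`, `numSetsFP`,
  `subsetAtFP`, `memSubsetAtFP` (`(I, j, e) ↦ [e ∈ S_j]`, the datum of `setSystem I`), `flatSetsFP`;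
* **the guard of `khotOutput` is decided in polynomial time** (`guardBool`, `guardBool_eq_true_iff`,
  `guardFP`): `Guard I` quantifies over ALL `e < u` with `u` in binary, which cannot be looped over;
  but the covering clause forces `u ≤ |flatten sets|` (`univSize_le_length_flatten_of_guard`: the `u`
  distinct covered elements are all listed), so `Guard I ↔ 1 ≤ K ≤ m ∧ 1 ≤ u ∧ u ≤ |flatten sets| ∧
  ∀ e < min u |flatten sets|, e ∈ flatten sets`, a loop of polynomial length; likewise the YES
  side-branch `yesBranchBool` (`u = 0 ∧ 1 ≤ K ≤ m`); `khotOutput_of_guard` / `khotOutput_of_not_guard`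
  restate the case split of `khotOutput` through these Booleans;
* the coin blocks of `coinDecode`: `blockFP`, `blockValFP` (`((1ʷ, 1ⁱ), c) ↦ ⟦block w c i⟧`,
  little-endian value, `bitsToNat`).

All proved, no facts (Arora–Barak 2009, §1.3: polynomial time is closed under composition and
polynomially bounded loops).

## References

* S. Khot, *Hardness of approximating the shortest vector problem in lattices*, J. ACM 52 (2005)
  789–808, §7.3 ("the reduction runs in time `n^{O(k²)}`").
* S. Arora, L. Babai, J. Stern, Z. Sweedyk, J. Comput. Syst. Sci. 54 (1997), Prop. 6 (p. 319) (the
  set cover instances).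
* S. Arora, B. Barak, *Computational Complexity: A Modern Approach*, CUP 2009, §0.1, §1.3.
-/

namespace Literature.Algebra.EuclideanLattices.Khot

open _root_.Computability Literature.Computability.Complexity Literature.Computability.Complexity.CodeFP
  Literature.Computability.MetaComplexity

/-! ### The instance code is a `CodeFP` product code -/

/-- The code of a set cover instance (`SetCoverInstance.encoding`, `GapSetCover.lean`). [cite: AroraEtAl1997, Prop. 6 (p. 319)] -/
abbrev scE : SetCoverInstance → List Bool := fun I => SetCoverInstance.encoding.encode I

/-- The same code on the tuple `(u, [S_j]_j, K)`, in the `CodeFP` vocabulary. [folklore] -/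
abbrev tupE : ℕ × List (List ℕ) × ℕ → List Bool := pairE natE (pairE (listE (listE natE)) natE)

/-- `code I = tupE (u, [S_j]_j, K)`. [folklore] -/
theorem scE_eq_tupE (I : SetCoverInstance) : scE I = tupE I.toTuple := by
  show (encodingNatBool.pairBool (encodingNatBool.listBool.listBool.pairBool encodingNatBool)).encode I.toTuple = _
  rw [pairE_eq, pairE_eq, listE_eq, listE_eq]
  rfl

/-- `I ↦ (u, [S_j]_j, K)` is the identity on codes. [folklore] -/
theorem toTupleFP : CodeFP scE tupE SetCoverInstance.toTuple :=
  transparent fun I => (scE_eq_tupE I).symm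

/-- The universe size `u` (binary). [cite: AroraBarak2009, §1.3] -/
theorem univSizeFP : CodeFP scE natE SetCoverInstance.univSize :=
  ((fst _ _).comp toTupleFP).congr fun _ => rfl

/-- The parameter `K` (binary). [cite: AroraBarak2009, §1.3] -/
theorem kFP : CodeFP scE natE SetCoverInstance.K :=
  ((snd _ _).snd'.comp toTupleFP).congr fun _ => rfl

/-- The list of sets as a raw list of raw lists. [cite: AroraBarak2009, §1.3] -/
theorem setsRawFP : CodeFP scE (rawE (rawE natE)) SetCoverInstance.sets :=
  ((map₀ (rawOfList natE)).comp ((rawOfList (listE natE)).comp ((snd _ _).fst'.comp toTupleFP))).congr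
    fun I => by simp [SetCoverInstance.toTuple]

/-- The number of sets `m = σ` (unary). [cite: AroraBarak2009, §1.3] -/
theorem numSetsFP : CodeFP scE unE (fun I => I.sets.length) :=
  (ulength (rawE natE)).comp setsRawFP

/-- The `j`-th set `S_j` (`subsetAt`, empty for `j ≥ m`), `j` in binary. [cite: AroraBarak2009, §1.3] -/
theorem subsetAtFP : CodeFP (pairE scE natE) (rawE natE) (fun p => p.1.subsetAt p.2) :=
  ((rawGetD (rawE natE) (d := ([] : List ℕ)) rfl).comp ((setsRawFP.comp (fst _ _)).pair (snd _ _))).congr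
    fun _ => rfl

/-- **Set membership on codes**: `(I, j, e) ↦ [e ∈ S_j]` — the datum `e ∈ setSystem I j` of Khot's
incidence block (`mem_setSystem`). [cite: AroraBarak2009, §1.3] -/
theorem memSubsetAtFP : CodeFP (pairE scE (pairE natE natE)) bitE (fun p => decide (p.2.2 ∈ p.1.subsetAt p.2.1)) :=
  (mem natE_injective).comp ((snd _ _).snd'.pair (subsetAtFP.comp ((fst _ _).pair (snd _ _).fst')))

/-- All listed elements, `flatten [S_j]_j`. [cite: AroraBarak2009, §1.3] -/
theorem flatSetsFP : CodeFP scE (rawE natE) (fun I => I.sets.flatten) :=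
  (flatten natE).comp setsRawFP

/-! ### The guard is decidable in polynomial time -/

/-- Listed means: in some set. [folklore] -/
theorem mem_flatten_sets_iff (I : SetCoverInstance) (e : ℕ) :
    e ∈ I.sets.flatten ↔ ∃ j < I.sets.length, e ∈ I.subsetAt j := by
  rw [List.mem_flatten]
  constructor
  · rintro ⟨l, hl, he⟩
    obtain ⟨j, hj, rfl⟩ := List.mem_iff_getElem.1 hl
    refine ⟨j, hj, ?_⟩
    simpa [SetCoverInstance.subsetAt, List.getD_eq_getElem?_getD, List.getElem?_eq_getElem hj] using he
  · rintro ⟨j, hj, he⟩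
    refine ⟨I.subsetAt j, ?_, he⟩
    simp [SetCoverInstance.subsetAt, List.getD_eq_getElem?_getD, List.getElem?_eq_getElem hj]

/-- On the guard the universe is no larger than the number of listed items: the `u` covered elements
are distinct members of `flatten [S_j]_j`. [folklore] -/
theorem univSize_le_length_flatten_of_cover {I : SetCoverInstance}
    (h : ∀ e < I.univSize, ∃ j < I.sets.length, e ∈ I.subsetAt j) : I.univSize ≤ I.sets.flatten.length := by
  have hsub : Finset.range I.univSize ⊆ I.sets.flatten.toFinset := fun e he => by
    rw [List.mem_toFinset]
    exact (mem_flatten_sets_iff I e).2 (h e (Finset.mem_range.1 he))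
  calc I.univSize = (Finset.range I.univSize).card := (Finset.card_range _).symm
    _ ≤ I.sets.flatten.toFinset.card := Finset.card_le_card hsub
    _ ≤ I.sets.flatten.length := List.toFinset_card_le _

/-- `Guard I` forces `u ≤ |flatten sets|`. [folklore] -/
theorem univSize_le_length_flatten_of_guard {I : SetCoverInstance} (h : Guard I) :
    I.univSize ≤ I.sets.flatten.length :=
  univSize_le_length_flatten_of_cover h.2.2.2

/-- **The guard as a Boolean program**: `1 ≤ K`, `K ≤ m`, `1 ≤ u`, `u ≤ |flatten sets|`, and every
`e < min u |flatten sets|` is listed (a loop of polynomial length). [folklore] -/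
def guardBool (I : SetCoverInstance) : Bool :=
  ((((decide (1 ≤ I.K) && decide (I.K ≤ I.sets.length)) && decide (1 ≤ I.univSize)) &&
      decide (I.univSize ≤ I.sets.flatten.length)) &&
    (List.range (min I.univSize I.sets.flatten.length)).all fun e => decide (e ∈ I.sets.flatten))

/-- **`guardBool` decides `Guard`.** [folklore] -/
theorem guardBool_eq_true_iff (I : SetCoverInstance) : guardBool I = true ↔ Guard I := by
  unfold guardBool Guard
  simp only [Bool.and_eq_true, decide_eq_true_eq, List.all_eq_true, List.mem_range]
  constructor
  · rintro ⟨⟨⟨⟨h1, h2⟩, h3⟩, h4⟩, h5⟩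
    refine ⟨h1, h2, h3, fun e he => (mem_flatten_sets_iff I e).1 (h5 e ?_)⟩
    rw [min_eq_left h4]
    exact he
  · rintro ⟨h1, h2, h3, h5⟩
    have h4 : I.univSize ≤ I.sets.flatten.length := univSize_le_length_flatten_of_cover h5
    refine ⟨⟨⟨⟨h1, h2⟩, h3⟩, h4⟩, fun e he => (mem_flatten_sets_iff I e).2 (h5 e ?_)⟩
    rwa [min_eq_left h4] at he

/-- `guardBool = false` off the guard. [folklore] -/
theorem guardBool_eq_false_iff (I : SetCoverInstance) : guardBool I = false ↔ ¬Guard I := by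
  rw [← guardBool_eq_true_iff, Bool.eq_false_iff]

/-- **The guard is decided on codes in polynomial time.** [cite: Khot2005, §7.3; AroraBarak2009, §1.3] -/
theorem guardFP : CodeFP scE bitE guardBool := by
  have h1 : CodeFP scE bitE (fun I => decide (1 ≤ I.K)) := natLe.comp ((const scE 1).pair kFP)
  have h2 : CodeFP scE bitE (fun I => decide (I.K ≤ I.sets.length)) := natLeUn.comp (kFP.pair numSetsFP)
  have h3 : CodeFP scE bitE (fun I => decide (1 ≤ I.univSize)) := natLe.comp ((const scE 1).pair univSizeFP)
  have hL : CodeFP scE unE (fun I => I.sets.flatten.length) := (ulength natE).comp flatSetsFP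
  have h4 : CodeFP scE bitE (fun I => decide (I.univSize ≤ I.sets.flatten.length)) :=
    natLeUn.comp (univSizeFP.pair hL)
  -- the loop: context = the flattened list, items = `range (min u |flatten|)`
  have hmem : CodeFP (pairE (rawE natE) natE) bitE (fun t => decide (t.2 ∈ t.1)) :=
    (mem natE_injective).comp ((snd _ _).pair (fst _ _))
  have hrange : CodeFP scE (rawE natE) (fun I => List.range (min I.univSize I.sets.flatten.length)) :=
    rangeOf.comp (hL.pair univSizeFP)
  have h5 : CodeFP scE bitE (fun I => (List.range (min I.univSize I.sets.flatten.length)).all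
      fun e => decide (e ∈ I.sets.flatten)) :=
    (all hmem).comp (flatSetsFP.pair hrange)
  exact ((((h1.and h2).and h3).and h4).and h5).congr fun I => rfl

/-- The YES side-branch of `khotOutput` (empty universe, `1 ≤ K ≤ m`) as a Boolean program. [folklore] -/
def yesBranchBool (I : SetCoverInstance) : Bool :=
  (decide (I.univSize = 0) && decide (1 ≤ I.K)) && decide (I.K ≤ I.sets.length)

/-- `yesBranchBool` decides the side condition. [folklore] -/
theorem yesBranchBool_eq_true_iff (I : SetCoverInstance) :
    yesBranchBool I = true ↔ I.univSize = 0 ∧ 1 ≤ I.K ∧ I.K ≤ I.sets.length := by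
  simp [yesBranchBool, and_assoc]

/-- The side condition is decided on codes in polynomial time. [cite: AroraBarak2009, §1.3] -/
theorem yesBranchFP : CodeFP scE bitE yesBranchBool := by
  have h1 : CodeFP scE bitE (fun I => decide (I.univSize = 0)) := natEq.comp (univSizeFP.pair (const scE 0))
  have h2 : CodeFP scE bitE (fun I => decide (1 ≤ I.K)) := natLe.comp ((const scE 1).pair kFP)
  have h3 : CodeFP scE bitE (fun I => decide (I.K ≤ I.sets.length)) := natLeUn.comp (kFP.pair numSetsFP)
  exact ((h1.and h2).and h3).congr fun I => rfl

/-- `khotOutput` on the guard, through the Boolean: Khot's main instance. [cite: Khot2005, §7.3] -/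
theorem khotOutput_of_guard (k : ℕ) (Δ : KhotData k) {I : SetCoverInstance} (h : Guard I) (c : List Bool) :
    khotOutput k Δ I c = khotMain k Δ I.univSize I.sets.length I.K h.2.2.1 (setSystem I) c := by
  unfold khotOutput
  rw [dif_pos h]

/-- `khotOutput` off the guard: the fixed YES instance on the side-branch, the fixed NO instance
otherwise. [cite: Khot2005, §7.3] -/
theorem khotOutput_of_not_guard (k : ℕ) (Δ : KhotData k) {I : SetCoverInstance} (h : ¬Guard I) (c : List Bool) :
    khotOutput k Δ I c = if yesBranchBool I then fixedYes else fixedNoPow k := by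
  unfold khotOutput
  rw [dif_neg h]
  by_cases hy : I.univSize = 0 ∧ 1 ≤ I.K ∧ I.K ≤ I.sets.length
  · rw [if_pos hy, if_pos ((yesBranchBool_eq_true_iff I).2 hy)]
  · rw [if_neg hy, if_neg (fun h' => hy ((yesBranchBool_eq_true_iff I).1 h'))]

/-! ### Coin blocks -/

/-- **A coin block on codes**: `((1ʷ, 1ⁱ), c) ↦ block w c i = (c.drop (i·w)).take w`. [cite: AroraBarak2009, §1.3] -/
theorem blockFP : CodeFP (pairE (pairE unE unE) strE) strE (fun p => block p.1.1 p.2 p.1.2) := by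
  have hmul : CodeFP (pairE (pairE unE unE) strE) unE (fun p => p.1.2 * p.1.1) :=
    ((ulength unitE).comp (unitsMul.comp ((replicateUnit.comp (fst _ _).snd').pair
      (replicateUnit.comp (fst _ _).fst')))).congr fun p => by simp
  exact (strTake.comp ((fst _ _).fst'.pair (strDrop.comp (hmul.pair (snd _ _))))).congr fun p => rfl

/-- **The value of a coin block** (little-endian, `bitsToNat`): `((1ʷ, 1ⁱ), c) ↦ ⟦block w c i⟧` — the
column indices `gOf` and the residues `rOf` of `coinDecode` are such values. [cite: Khot2005, §5.2.2 and Lemma 4.3] -/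
theorem blockValFP : CodeFP (pairE (pairE unE unE) strE) natE (fun p => bitsToNat (block p.1.1 p.2 p.1.2)) :=
  strVal.comp blockFP

end Literature.Algebra.EuclideanLattices.Khot
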